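import Literature.NumberTheory.ConnesConsani2021.ArchKernelTier2Panels
import HarnessLib

/-!
# (E-a) Tier 2 — kernel reproduction of the panel data in FLAT form, group 7 (coarse panels 28..31)

RH-FREE certified-numerics plumbing (cell rh-crit, seat rh-crit-cc-iso g4).  Same computation as
`ArchKernelTier2PanelsCheck7.lean`, but each equality is stated MATCH-FREE and one panel per theorem —
`subSups (tsubI (sigmaTM K) ((s8TM hQ 6 (centre K) combinedLit).getD [])) = panelM[K]` — which is the exact shape the
read-back `ArchCertT2.hM_of_subSups` / `tier2_hM_of` (T2d soundness) consumes by `exact`, with no definitional unfolding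
of the certificate data in any later proof (rewriting under the `match` of `panelSups` makes the kernel unfold the data:
«deep recursion»).  `decide +kernel` only (≈ 4 × 30 s), standard axioms.
WHAT THIS IS NOT: a statement about the prolate functions or about RH; nothing here bears on the truth of RH.
-/

open Literature.Analysis.ValidatedNumerics.PolyMP
open Literature.NumberTheory.ConnesConsani2021.ArchCertSigma (sigmaTM hQ)

namespace Literature.NumberTheory.ConnesConsani2021.ArchCertT2

set_option maxRecDepth 200000 in
/-- **Flat panel fact 28**: the kernel's 32 sub-panel sups of `sigmaTM 28 − s8TM` ARE row 28 of `panelM`. [cite: ConnesConsani2021, §6.4 Fact 6.1 + Lemma 6.3 p. 24 (in-kernel (E-a) certificate); §6.3 p. 24] -/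
theorem panelFlat_28 :
    subSups (tsubI (sigmaTM 28) ((s8TM hQ 6 (centre 28) combinedLit).getD [])) = panelM.getD 28 [] := by
  decide +kernel

set_option maxRecDepth 200000 in
/-- **Flat panel fact 29**: the kernel's 32 sub-panel sups of `sigmaTM 29 − s8TM` ARE row 29 of `panelM`. [cite: ConnesConsani2021, §6.4 Fact 6.1 + Lemma 6.3 p. 24 (in-kernel (E-a) certificate); §6.3 p. 24] -/
theorem panelFlat_29 :
    subSups (tsubI (sigmaTM 29) ((s8TM hQ 6 (centre 29) combinedLit).getD [])) = panelM.getD 29 [] := by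
  decide +kernel

set_option maxRecDepth 200000 in
/-- **Flat panel fact 30**: the kernel's 32 sub-panel sups of `sigmaTM 30 − s8TM` ARE row 30 of `panelM`. [cite: ConnesConsani2021, §6.4 Fact 6.1 + Lemma 6.3 p. 24 (in-kernel (E-a) certificate); §6.3 p. 24] -/
theorem panelFlat_30 :
    subSups (tsubI (sigmaTM 30) ((s8TM hQ 6 (centre 30) combinedLit).getD [])) = panelM.getD 30 [] := by
  decide +kernel

set_option maxRecDepth 200000 in
/-- **Flat panel fact 31**: the kernel's 32 sub-panel sups of `sigmaTM 31 − s8TM` ARE row 31 of `panelM`. [cite: ConnesConsani2021, §6.4 Fact 6.1 + Lemma 6.3 p. 24 (in-kernel (E-a) certificate); §6.3 p. 24] -/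
theorem panelFlat_31 :
    subSups (tsubI (sigmaTM 31) ((s8TM hQ 6 (centre 31) combinedLit).getD [])) = panelM.getD 31 [] := by
  decide +kernel

end Literature.NumberTheory.ConnesConsani2021.ArchCertT2
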